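/-
Origin: expansion seat `prover-pub-hodgecm-mc-carch-1-g2-0`, handover #CA11 2026-08-20T01:44Z md5 be0cab3d54ab (467 l., 12 decls; NEW additive leaf; imports Model.ArchKTypeOfFrame (#CA4v3), Model.ArchKTypeOfOmega (#CA9), Model.HypCensus.TorusBlock (RUN 36), Vendored…KonnoKonno2007.RealUnitaryDualPairBallFrame (installed), Vendored.H21.AlgebraicGeometry.ShimuraVarieties.UnitaryBallCotangentWeight (K-1 twin of tree p182127 b26478e96bab, NOT YET CUT — head request to glue-2; a leaf over the installed twins UnitaryBallAutomorphicForms + UnitBallIsotropyBlock); RUN 38; INSTALL after #CA4v3, #CA9 and that twin; cert certs/ax-ArchKTypeOfHarm-be0cab3d54ab.log: mirror world rc 0 / 40 s / 0 warnings / 12/12 trio) (`HOME/mc/pub-hodgecm-mc-carch-1/pkg38/HodgeCM/Model/ArchKTypeOfHarm.lean`, md5 be0cab3d54ab, 467 lines);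
landed by the second packager (p2) in gate run 38 as `HodgeCM/Model/ArchKTypeOfHarm.lean` (verbatim).
-/
/-
Copyright (c) 2026. Released under Apache 2.0 license as described in the file LICENSE.
Cell pub-hodgecm, MODEL layer (construction prover mc-carch-1, gen 2), BINDER-OWNERS row 12 `C`: the last junction (W-K∞′) `harm`
of the honest-pin term `Model/ArchKTypeOf.archKTypeOf` at `ωA := lineOmega_k` (#CA9) and `Φarch := blockFamilyOf … Φ₁ Φ₂` (#CA4),
REDUCED to the pin's vacuum character at the place under `ι₁` (binder-2 `HypCensus/TorusBlock`), the `μ₀`-type of the local family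
`Φ₁` (theta-3), and ONE scalar identity on `K_∞ = U(2) × U(1)` for the line scalar `c_k`.
-/
import Summits.HodgeConjecture.HodgeCM.Model.ArchKTypeOfFrame
import Summits.HodgeConjecture.HodgeCM.Model.ArchKTypeOfOmega
import Summits.HodgeConjecture.HodgeCM.Model.HypCensus.TorusBlock
import Literature.RepresentationTheory.KonnoKonno2007.RealUnitaryDualPairBallFrame
import Literature.AlgebraicGeometry.ShimuraVarieties.UnitaryBallCotangentWeight

/-!
# (W-K∞′) `harm` for the honest-pin term: `ωA_k u (Φarch ℓ) = Φarch (τ₁^∨ u ℓ)` from the vacuum character of the pin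

`Model/ArchKTypeOf.archKTypeOf … ωA hA Φarch ℓ₀ arch₀ hfix harm` asks (W-K∞′)
`harm : ∀ (u : Stab_{U21}(x₀)) ℓ, ωA u (Φarch ℓ) = Φarch ((weightOf x₀)^∨ u ℓ)` for the archimedean factor `ωA` and the
harmonic family `Φarch`.  At the S pin of record `ωA := lineOmega_k = smulPull c_k (cmArchWeilRep e₁ hGR_k) (archSectionFrameOf V, 1)`
(#CA9 `Model/ArchKTypeOfOmega`) and `Φarch := blockFamilyOf … (blockPosEquiv V) (blockNegEquiv V) Φ₁ Φ₂`, `ℓ ↦ τ (Φ₁ ℓ ⊠ Φ₂)`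
(#CA4 `Model/ArchKTypeOfFrame`; theta-3 ARCHLINE-SPEC (eP/eQ) ADOPTED).  This file proves `harm` for every representation of the
shape `smulPull χ (cmArchWeilRep e (frameD V) dW hGR) (archSectionFrameOf V, 1)` (all four lines at once) from FOUR inputs, each
in its owner's currency:

* (F) `hsec : ∀ u ∈ Stab(x₀), cmBlockSection eP eQ (u21FrameEquiv u, 1) = (archSectionFrameOf V u, 1)` — the frame matching
  (J-x₀)⇄(J-arch) on the stabiliser in the UNTWISTED form (= #CA8 `cmBlockSection_twist` under route (a) of (TWIST-2), where
  binder-2's `v₁`-factor is read through `ι₁` and `twistU21 = id`; in today's bytes it is `cmBlockSection_u21FrameEquiv` in the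
  branch `(mk ι₁).embedding = ι₁`);
* (K) `hK : ∀ kk Φ, cmBlockRep (cmBlockSection (κ kk)) (Φ ⊠ Φ₂) = (κOp ev kk Φ) ⊠ Φ₂` — the compact group of the slot acts on
  product vectors by Folland's `κOp ev = vacScalar ev • μ₀(dualPairι ·)` with ONE exponent tuple `ev` = the VACUUM CHARACTER OF
  THE PIN at `v₁` (binder-2 `HypCensus/TorusBlock.exists_vacExponents_cmBlockRepAt_κ_tensorPi`, re-read here for discharge-3's
  `cmBlockRep`/`cmBlockSection` by `rfl`: § 1 `exists_vacExponents_cmBlockRep_κ_tensorPi`, with `ev.eP − ev.eQ = |R| − |S|` pinned);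
* (Φ) `hΦ₁ : ∀ kV b, μ₀(dualPairι (kV, 1)) (Φ₁ ⟨b, ·⟩) = Φ₁ ⟨kV.1 b, ·⟩` — the local family has the STANDARD `μ₀`-type on
  `U(2) × U(1)` and is fixed by `K′` (for `Φ₁ := degOneP ∘ ⟨·,·⟩⁻¹` this is the tree's `unitaryOpPi_dualPairι_degOneP_fst`
  [Folland 1989, Prop. (4.39)], theta-3's (E1) family up to the relabelling of its block);
* (χ) `hχ : ∀ u ∈ Stab(x₀), c(u) · det A(u) ^ ev.eP · d(u) ^ ev.eQ = conj d(u)` (`stabilizerEquivK21⁻¹ u = (A(u), d(u))`) — the line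
  scalar times the pin's vacuum character on `K_∞` IS `𝔭₊`'s central twist `d̄` (the one identity the twist character `η_k` of the
  S family is normalised for; owner: the S-instance / theta lane, (S-norm)/(C3)).

Contents:
* § 1 the `…At` bridge (`cmBlockRep = cmBlockRepAt v₁ eP eQ refl refl`, `cmBlockSection = …`, both `rfl`) and
  **`exists_vacExponents_cmBlockRep_κ_tensorPi`** (binder-2's theorem in discharge-3's currency, `V`-difference pinned);
* § 2 the stabiliser in the block frame: `frame_stabilizer_eq_κ'` (`(u21FrameEquiv u, 1) = κ ((A(u), (d(u))), 1)`, any `R S`),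
  `vacScalar_stabilizer` (`vacScalar ev ((A,(d)),1) = det A ^ e_P * d ^ e_Q`);
* § 3 **`smulPull_blockFamilyOf_stabilizer`** — the `K_∞`-ACTION on the harmonic family:
  `(smulPull χ ω (s_V,1)) u (blockFamilyOf Φ₁ Φ₂ ⟨b,·⟩) = (χ u · vacScalar ev kk(u)) • blockFamilyOf Φ₁ Φ₂ ⟨A(u) b, ·⟩` from (F)(K)(Φ);
  **`smulPull_blockFamilyOf_harm`** — (W-K∞′) from (F)(K)(Φ)(χ):
  `(smulPull χ ω (s_V,1)) u (blockFamilyOf Φ₁ Φ₂ ℓ) = blockFamilyOf Φ₁ Φ₂ ((weightOf x₀)^∨ u ℓ)`;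
  `lineScalar_identity_of_exponents` — (χ) from `c = det^m · d^{m'}` on `K_∞` with `m + e_P = 0`, `m' + e_Q = −1`;
* § 4 the four lines of record: **`lineOmega_zero_harm`** … **`lineOmega_three_harm`** — LITERALLY the `harm` hypothesis of
  `archKTypeOf … (lineOmega_k …) … (blockFamilyOf (L:Type) e₁ (frameD V) … (lineVec (d_k)) … ι₁ (blockPosEquiv V) (blockNegEquiv V) Φ₁ Φ₂) …`.

Nothing is cited and nothing is minted: kernel lemmas over installed RUN-36/37 modules, #CA4/#CA9 and the K-1 twin of tree
`AlgebraicGeometry/ShimuraVarieties/UnitaryBallCotangentWeight` (`weightOf_cotangent_dual_apply`, theta-2); 0 records, 0 `def … : Prop`.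
-/

set_option autoImplicit false

noncomputable section

open NumberField NumberField.InfinitePlace NumberField.mixedEmbedding IsDedekindDomain MeasureTheory
open scoped Matrix TensorProduct Classical SchwartzMap
open MulAction
open Literature.Geometry.ComplexHyperbolic.BallModel (U21 x₀ stabilizerEquivK21)
open Literature.NumberTheory.Automorphic.U21 (K21 matA sclD pPlus pPlus_apply)
open Literature.AlgebraicGeometry.ShimuraVarieties.BallForms (isPullbackCocycle_cotangentCocycle weightOf_cotangent_dual_apply)
open Literature.NumberTheory.Automorphic Literature.NumberTheory.Weil1964
open Literature.RepresentationTheory.KonnoKonno2007 Literature.RepresentationTheory.KonnoKonno2007.RealDualPair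
open Literature.NumberTheory.GelbartRogawski1991 Literature.NumberTheory.GelbartRogawski1991.UnitaryDualPair
open Literature.Analysis.SegalBargmann
open HodgeCM.Adelic HodgeCM.PerL34 HodgeCM.Model.HypCensus

namespace HodgeCM.Model

/-! ## § 1 Binder-2's vacuum character of the pin, in discharge-3's currency -/

section Bridge

variable (L : Type) [Field L] [NumberField L] [IsCMField L] {N M n : ℕ} (e : Fin N × Fin M ≃ Fin n)
variable (dV : Fin N → L) (hdV : ∀ i, IsCMField.complexConj L (dV i) = dV i) (hdV0 : ∀ i, dV i ≠ 0)
variable (dW : Fin M → L) (hdW : ∀ i, IsCMField.complexConj L (dW i) = dW i) (hdW0 : ∀ i, dW i ≠ 0)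
variable (hGR : (cmSplittingDatum L e dV hdV hdV0 dW hdW hdW0).CompatibleSplitting) (ι₁ : L →+* ℂ)
variable (eP : PosIdx (cmXV L dV hdV ι₁ (cmPlace L ι₁)) ≃ Fin 2) (eQ : NegIdx (cmXV L dV hdV ι₁ (cmPlace L ι₁)) ≃ Unit)

/-- discharge-3's block-frame datum IS binder-2's `…At` datum at `v₁ = cmPlace ι₁` with `eR = eS = refl` (same composite). -/
theorem cmBlockRep_eq_cmBlockRepAt :
    cmBlockRep L e dV hdV hdV0 dW hdW hdW0 hGR ι₁ eP eQ =
      cmBlockRepAt L e dV hdV hdV0 dW hdW hdW0 hGR ι₁ (cmPlace L ι₁) eP eQ (Equiv.refl _) (Equiv.refl _) :=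
  rfl

/-- the same for the block sections. -/
theorem cmBlockSection_eq_cmBlockSectionAt :
    cmBlockSection L dV hdV hdV0 dW hdW hdW0 ι₁ eP eQ =
      cmBlockSectionAt L dV hdV hdV0 dW hdW hdW0 ι₁ (cmPlace L ι₁) eP eQ (Equiv.refl _) (Equiv.refl _) :=
  rfl

/-- **The vacuum character of the pin at `v₁`** (binder-2 `TorusBlock`, discharge-3's currency): from the sign facts and ANY small
archimedean Weil datum of the slot, ONE exponent tuple `ev` — a Fock vacuum character of Konno–Konno's junction, with the `V`-side
difference PINNED `ev.eP − ev.eQ = |R| − |S|` — such that the compact group acts on product vectors by `κOp ev` on the first factor: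
`cmBlockRep (cmBlockSection (κ kk)) (Φ₁ ⊠ Φ₂) = (κOp ev kk Φ₁) ⊠ Φ₂`. -/
theorem exists_vacExponents_cmBlockRep_κ_tensorPi
    (h₁V : ∃ i₀ : Fin N, (∀ i, i ≠ i₀ → 0 < (ι₁ (dV i)).re) ∨ ∀ i, i ≠ i₀ → (ι₁ (dV i)).re < 0)
    (h₁W : (∀ j, 0 < (ι₁ (dW j)).re) ∨ ∀ j, (ι₁ (dW j)).re < 0)
    (hV : ∀ τ : L →+* ℂ, InfinitePlace.mk τ ≠ InfinitePlace.mk ι₁ → (∀ i, 0 < (τ (dV i)).re) ∨ ∀ i, (τ (dV i)).re < 0)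
    (hW : ∀ τ : L →+* ℂ, InfinitePlace.mk τ ≠ InfinitePlace.mk ι₁ →
      (∃ j₀ : Fin M, ∀ j, j ≠ j₀ → 0 < (τ (dW j)).re) ∨ ∀ j, (τ (dW j)).re < 0)
    {ω₁ : Representation ℂ
      (Ginf (Fin 2) Unit (PosIdx (cmXW L dV dW hdW ι₁ (cmPlace L ι₁))) (NegIdx (cmXW L dV dW hdW ι₁ (cmPlace L ι₁))))
      (SchwartzMap (DPIdx (Fin 2) Unit (PosIdx (cmXW L dV dW hdW ι₁ (cmPlace L ι₁))) (NegIdx (cmXW L dV dW hdW ι₁ (cmPlace L ι₁))) → ℝ) ℂ)}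
    (hW₁ : IsArchWeilDatum
      (ι𝕎 (Fin 2) Unit (PosIdx (cmXW L dV dW hdW ι₁ (cmPlace L ι₁))) (NegIdx (cmXW L dV dW hdW ι₁ (cmPlace L ι₁)))) ω₁)
    (hc₁ : ∀ u, Continuous (ω₁ u)) :
    ∃ ev : VacExponents,
      (junction (Fin 2) Unit (PosIdx (cmXW L dV dW hdW ι₁ (cmPlace L ι₁)))
          (NegIdx (cmXW L dV dW hdW ι₁ (cmPlace L ι₁)))).FockVacuumCharacter ev ∧
      ev.eP - ev.eQ = (Fintype.card (PosIdx (cmXW L dV dW hdW ι₁ (cmPlace L ι₁))) : ℤ) -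
          Fintype.card (NegIdx (cmXW L dV dW hdW ι₁ (cmPlace L ι₁))) ∧
      ∀ (kk : DPK (Fin 2) Unit (PosIdx (cmXW L dV dW hdW ι₁ (cmPlace L ι₁))) (NegIdx (cmXW L dV dW hdW ι₁ (cmPlace L ι₁))))
        (Φ₁ : SchwartzMap (DPIdx (Fin 2) Unit (PosIdx (cmXW L dV dW hdW ι₁ (cmPlace L ι₁)))
          (NegIdx (cmXW L dV dW hdW ι₁ (cmPlace L ι₁))) → ℝ) ℂ)
        (Φ₂ : SchwartzMap ((Fin n × {w : {w : InfinitePlace ↥(maximalRealSubfield L) // w.IsReal} // w ≠ cmPlace L ι₁}) → ℝ) ℂ),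
        cmBlockRep L e dV hdV hdV0 dW hdW hdW0 hGR ι₁ eP eQ (cmBlockSection L dV hdV hdV0 dW hdW hdW0 ι₁ eP eQ (κ _ _ _ _ kk))
            (tensorPi Φ₁ Φ₂) =
          tensorPi (κOp _ _ ev kk Φ₁) Φ₂ := by
  obtain ⟨ev, hfv, h⟩ := exists_vacExponents_cmBlockRepAt_κ_tensorPi L e dV hdV hdV0 dW hdW hdW0 hGR ι₁ (cmPlace L ι₁) eP eQ
    (Equiv.refl _) (Equiv.refl _) h₁V h₁W hV hW hW₁ hc₁
  exact ⟨ev, hfv, eP_sub_eQ hfv 0 (), h⟩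

end Bridge

/-! ## § 2 The stabiliser of `x₀` in the block frame -/

section Frame

variable {R S : Type} [Fintype R] [DecidableEq R] [Fintype S] [DecidableEq S]

/-- **`(u21FrameEquiv u, 1) = κ ((A(u), (d(u))), 1)`** for `u ∈ Stab_{U21}(x₀)`, `stabilizerEquivK21⁻¹ u = (A(u), d(u))`, any second
member `U(R,S)` (tree `u21FrameEquiv_stabilizer`, [KonnoKonno2007, §3.1]). -/
theorem frame_stabilizer_eq_κ' (u : stabilizer U21 x₀) :
    ((u21FrameEquiv (u : U21), (1 : UForm R S)) : Ginf (Fin 2) Unit R S) =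
      κ (Fin 2) Unit R S (((stabilizerEquivK21.symm u).1, unitaryToUnit (stabilizerEquivK21.symm u).2), 1) := by
  rw [u21FrameEquiv_stabilizer, ← map_one (UForm.kV R S)]
  rfl

/-- `vacScalar ev ((A, (d)), 1) = det A ^ e_P * d ^ e_Q`. -/
theorem vacScalar_stabilizer (ev : VacExponents) (k : K21) :
    vacScalar ev ((((k.1, unitaryToUnit k.2) : Matrix.unitaryGroup (Fin 2) ℂ × Matrix.unitaryGroup Unit ℂ), 1) : DPK (Fin 2) Unit R S) =
      (matA k).det ^ ev.eP * sclD k ^ ev.eQ := by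
  simp [vacScalar]

end Frame

/-! ## § 3 The `K_∞`-action on the harmonic family and (W-K∞′) -/

section Harm

variable {L : CMField} {ι₁ : L →+* ℂ} (V : HermSpace3 L ι₁)
variable {M' : ℕ} (e : Fin 3 × Fin M' ≃ Fin 3)
  (dW : Fin M' → (L : Type)) (hdW : ∀ i, IsCMField.complexConj (L : Type) (dW i) = dW i) (hdW0 : ∀ i, dW i ≠ 0)
  (hGR : (cmSplittingDatum (L : Type) e (frameD V) (frameD_real V) (frameD_ne V) dW hdW hdW0).CompatibleSplitting)
  (χ : U21 →* ℂˣ)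
  (Φ₁ : Module.Dual ℂ (Fin 2 → ℂ) →ₗ[ℂ]
    SchwartzMap (DPIdx (Fin 2) Unit (PosIdx (cmXW (L : Type) (frameD V) dW hdW ι₁ (cmPlace (L : Type) ι₁)))
      (NegIdx (cmXW (L : Type) (frameD V) dW hdW ι₁ (cmPlace (L : Type) ι₁))) → ℝ) ℂ)
  (Φ₂ : SchwartzMap ((Fin 3 × {v : {v : InfinitePlace ↥(maximalRealSubfield L) // v.IsReal} // v ≠ cmPlace (L : Type) ι₁}) → ℝ) ℂ)

/-- **The `K_∞`-ACTION ON THE HARMONIC FAMILY.**  For `u ∈ Stab(x₀)` with `stabilizerEquivK21⁻¹ u = (A, d)`: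
`(χ u • ω (archSectionFrameOf V u, 1)) (τ (Φ₁ ⟨b,·⟩ ⊠ Φ₂)) = (χ u · vacScalar ev ((A,(d)),1)) • τ (Φ₁ ⟨A b,·⟩ ⊠ Φ₂)`, from the frame
matching on the stabiliser (F), the pin's vacuum character (K) and the `μ₀`-type of the local family (Φ). -/
theorem smulPull_blockFamilyOf_stabilizer
    (hsec : ∀ u : stabilizer U21 x₀,
      cmBlockSection (L : Type) (frameD V) (frameD_real V) (frameD_ne V) dW hdW hdW0 ι₁ (blockPosEquiv V) (blockNegEquiv V)
          (u21FrameEquiv (u : U21), 1) = (archSectionFrameOf V u, 1))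
    {ev : VacExponents}
    (hK : ∀ (kk : DPK (Fin 2) Unit (PosIdx (cmXW (L : Type) (frameD V) dW hdW ι₁ (cmPlace (L : Type) ι₁)))
        (NegIdx (cmXW (L : Type) (frameD V) dW hdW ι₁ (cmPlace (L : Type) ι₁))))
      (Φ : SchwartzMap (DPIdx (Fin 2) Unit (PosIdx (cmXW (L : Type) (frameD V) dW hdW ι₁ (cmPlace (L : Type) ι₁)))
        (NegIdx (cmXW (L : Type) (frameD V) dW hdW ι₁ (cmPlace (L : Type) ι₁))) → ℝ) ℂ),
      cmBlockRep (L : Type) e (frameD V) (frameD_real V) (frameD_ne V) dW hdW hdW0 hGR ι₁ (blockPosEquiv V) (blockNegEquiv V)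
          (cmBlockSection (L : Type) (frameD V) (frameD_real V) (frameD_ne V) dW hdW hdW0 ι₁ (blockPosEquiv V) (blockNegEquiv V)
            (κ _ _ _ _ kk)) (tensorPi Φ Φ₂) =
        tensorPi (κOp _ _ ev kk Φ) Φ₂)
    (hΦ₁ : ∀ (kV : Matrix.unitaryGroup (Fin 2) ℂ × Matrix.unitaryGroup Unit ℂ) (b : Fin 2 → ℂ),
      unitaryOpPi (dualPairι ((kV, 1) : DPK (Fin 2) Unit (PosIdx (cmXW (L : Type) (frameD V) dW hdW ι₁ (cmPlace (L : Type) ι₁)))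
          (NegIdx (cmXW (L : Type) (frameD V) dW hdW ι₁ (cmPlace (L : Type) ι₁)))))
          (Φ₁ (dotProductEquiv ℂ (Fin 2) b)) =
        Φ₁ (dotProductEquiv ℂ (Fin 2) ((kV.1 : Matrix (Fin 2) (Fin 2) ℂ) *ᵥ b)))
    (u : stabilizer U21 x₀) (b : Fin 2 → ℂ) :
    Representation.smulPull χ (cmArchWeilRep (L : Type) e (frameD V) (frameD_real V) (frameD_ne V) dW hdW hdW0 hGR)
        (MonoidHom.prod (archSectionFrameOf V) 1) (u : U21)
        (blockFamilyOf (L : Type) e (frameD V) (frameD_real V) (frameD_ne V) dW hdW hdW0 ι₁ (blockPosEquiv V) (blockNegEquiv V)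
          Φ₁ Φ₂ (dotProductEquiv ℂ (Fin 2) b)) =
      (((χ (u : U21) : ℂˣ) : ℂ) *
          vacScalar ev (((((stabilizerEquivK21.symm u).1, unitaryToUnit (stabilizerEquivK21.symm u).2) :
              Matrix.unitaryGroup (Fin 2) ℂ × Matrix.unitaryGroup Unit ℂ), 1) :
            DPK (Fin 2) Unit (PosIdx (cmXW (L : Type) (frameD V) dW hdW ι₁ (cmPlace (L : Type) ι₁)))
              (NegIdx (cmXW (L : Type) (frameD V) dW hdW ι₁ (cmPlace (L : Type) ι₁))))) •
        blockFamilyOf (L : Type) e (frameD V) (frameD_real V) (frameD_ne V) dW hdW hdW0 ι₁ (blockPosEquiv V) (blockNegEquiv V)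
          Φ₁ Φ₂ (dotProductEquiv ℂ (Fin 2) (matA (stabilizerEquivK21.symm u) *ᵥ b)) := by
  rw [Representation.smulPull_apply, LinearMap.smul_apply, MonoidHom.prod_apply, MonoidHom.one_apply, ← hsec u,
    frame_stabilizer_eq_κ', blockFamilyOf_apply, blockFamilyOf_apply, sumProdLeftCLM_apply_eq_tensorPi,
    sumProdLeftCLM_apply_eq_tensorPi, cmArchWeilRep_cmBlockTransport_symm, hK, κOp, _root_.smul_apply, hΦ₁,
    tensorPi_smul_left, map_smul, smul_smul]

/-- **(W-K∞′) `harm` FOR A LINE OF THE HONEST PIN.**  With (F), (K), (Φ) as above and the scalar identity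
(χ) `c(u) · det A(u) ^ e_P · d(u) ^ e_Q = conj d(u)` on `Stab(x₀)`:
`(smulPull χ ω (s_V, 1)) u (blockFamilyOf Φ₁ Φ₂ ℓ) = blockFamilyOf Φ₁ Φ₂ ((weightOf x₀)^∨ u ℓ)` for every `u ∈ Stab(x₀)` and `ℓ`
(`(weightOf x₀)^∨ = 𝔭₊ : (A,d) · ⟨b,·⟩ = ⟨d̄ • A b, ·⟩`, tree `weightOf_cotangent_dual_apply`). -/
theorem smulPull_blockFamilyOf_harm
    (hsec : ∀ u : stabilizer U21 x₀,
      cmBlockSection (L : Type) (frameD V) (frameD_real V) (frameD_ne V) dW hdW hdW0 ι₁ (blockPosEquiv V) (blockNegEquiv V)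
          (u21FrameEquiv (u : U21), 1) = (archSectionFrameOf V u, 1))
    {ev : VacExponents}
    (hK : ∀ (kk : DPK (Fin 2) Unit (PosIdx (cmXW (L : Type) (frameD V) dW hdW ι₁ (cmPlace (L : Type) ι₁)))
        (NegIdx (cmXW (L : Type) (frameD V) dW hdW ι₁ (cmPlace (L : Type) ι₁))))
      (Φ : SchwartzMap (DPIdx (Fin 2) Unit (PosIdx (cmXW (L : Type) (frameD V) dW hdW ι₁ (cmPlace (L : Type) ι₁)))
        (NegIdx (cmXW (L : Type) (frameD V) dW hdW ι₁ (cmPlace (L : Type) ι₁))) → ℝ) ℂ),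
      cmBlockRep (L : Type) e (frameD V) (frameD_real V) (frameD_ne V) dW hdW hdW0 hGR ι₁ (blockPosEquiv V) (blockNegEquiv V)
          (cmBlockSection (L : Type) (frameD V) (frameD_real V) (frameD_ne V) dW hdW hdW0 ι₁ (blockPosEquiv V) (blockNegEquiv V)
            (κ _ _ _ _ kk)) (tensorPi Φ Φ₂) =
        tensorPi (κOp _ _ ev kk Φ) Φ₂)
    (hΦ₁ : ∀ (kV : Matrix.unitaryGroup (Fin 2) ℂ × Matrix.unitaryGroup Unit ℂ) (b : Fin 2 → ℂ),
      unitaryOpPi (dualPairι ((kV, 1) : DPK (Fin 2) Unit (PosIdx (cmXW (L : Type) (frameD V) dW hdW ι₁ (cmPlace (L : Type) ι₁)))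
          (NegIdx (cmXW (L : Type) (frameD V) dW hdW ι₁ (cmPlace (L : Type) ι₁)))))
          (Φ₁ (dotProductEquiv ℂ (Fin 2) b)) =
        Φ₁ (dotProductEquiv ℂ (Fin 2) ((kV.1 : Matrix (Fin 2) (Fin 2) ℂ) *ᵥ b)))
    (hχ : ∀ u : stabilizer U21 x₀,
      ((χ (u : U21) : ℂˣ) : ℂ) * ((matA (stabilizerEquivK21.symm u)).det ^ ev.eP * sclD (stabilizerEquivK21.symm u) ^ ev.eQ) =
        star (sclD (stabilizerEquivK21.symm u)))
    (u : stabilizer U21 x₀) (ℓ : Module.Dual ℂ (Fin 2 → ℂ)) :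
    Representation.smulPull χ (cmArchWeilRep (L : Type) e (frameD V) (frameD_real V) (frameD_ne V) dW hdW hdW0 hGR)
        (MonoidHom.prod (archSectionFrameOf V) 1) (u : U21)
        (blockFamilyOf (L : Type) e (frameD V) (frameD_real V) (frameD_ne V) dW hdW hdW0 ι₁ (blockPosEquiv V) (blockNegEquiv V)
          Φ₁ Φ₂ ℓ) =
      blockFamilyOf (L : Type) e (frameD V) (frameD_real V) (frameD_ne V) dW hdW hdW0 ι₁ (blockPosEquiv V) (blockNegEquiv V) Φ₁ Φ₂
        ((isPullbackCocycle_cotangentCocycle.weightOf x₀).dual u ℓ) := by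
  obtain ⟨b, rfl⟩ := (dotProductEquiv ℂ (Fin 2)).surjective ℓ
  rw [smulPull_blockFamilyOf_stabilizer V e dW hdW hdW0 hGR χ Φ₁ Φ₂ hsec hK hΦ₁, vacScalar_stabilizer, hχ u,
    weightOf_cotangent_dual_apply, pPlus_apply, map_smul, map_smul]

/-- **The scalar identity (χ) from EXPONENTS.**  If the line scalar is a determinant-power character on `K_∞`,
`c(u) = det A(u) ^ m · d(u) ^ m'`, then (χ) holds as soon as `m + e_P = 0` and `m' + e_Q = −1` — the archimedean normalisation
of the twist character of the line against the pin's vacuum character at `v₁`.  (Conversely, for `c = φ ∘ det` — every character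
of `U(2,1)` — (χ) at `A = diag(z,1), d = 1` and at `A = 1, d = z` forces `e_P = e_Q + 1`, i.e. `|R| − |S| = 1` by § 1: the line must
be POSITIVE at `v₁`, the same instance `IsEmpty S` that row 15's `hf` needs.) -/
theorem lineScalar_identity_of_exponents {χ : U21 →* ℂˣ} {ev : VacExponents} {m m' : ℤ}
    (hχ : ∀ u : stabilizer U21 x₀,
      ((χ (u : U21) : ℂˣ) : ℂ) = (matA (stabilizerEquivK21.symm u)).det ^ m * sclD (stabilizerEquivK21.symm u) ^ m')
    (hm : m + ev.eP = 0) (hm' : m' + ev.eQ = -1) (u : stabilizer U21 x₀) :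
    ((χ (u : U21) : ℂˣ) : ℂ) * ((matA (stabilizerEquivK21.symm u)).det ^ ev.eP * sclD (stabilizerEquivK21.symm u) ^ ev.eQ) =
      star (sclD (stabilizerEquivK21.symm u)) := by
  set k := stabilizerEquivK21.symm u
  have hA : (matA k).det ≠ 0 := by
    have h := Matrix.UnitaryGroup.det_isUnit k.1
    exact h.ne_zero
  have hd1 : star (sclD k) * sclD k = 1 := Unitary.coe_star_mul_self k.2
  have hd : sclD k ≠ 0 := fun h => by simp [h] at hd1
  have hstar : star (sclD k) = sclD k ^ (-1 : ℤ) := by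
    rw [zpow_neg_one]
    exact eq_inv_of_mul_eq_one_left hd1
  rw [hχ u, hstar, mul_mul_mul_comm, ← zpow_add₀ hA, ← zpow_add₀ hd, hm, hm', zpow_zero, one_mul]

end Harm

/-! ## § 4 The four lines of record: the `harm` hypothesis of `archKTypeOf` at `ωA := lineOmega_k` -/

namespace ArchSideTerm

variable {L : CMField} {ι₁ : L →+* ℂ} (V : HermSpace3 L ι₁) (S : StubTree.SeesawDatum L)

variable
  (hGR : (cmSplittingDatum (L : Type) finProdFinEquiv (frameD V) (frameD_real V) (frameD_ne V) (dW S) (dW_real S) (dW_ne S)).CompatibleSplitting)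
  (hGR₀ : (cmSplittingDatum (L : Type) (e₁) (frameD V) (frameD_real V) (frameD_ne V) (lineVec (L : Type) (dW S 0))
    (fun _ => dW_real S 0) (fun _ => dW_ne S 0)).CompatibleSplitting)
  (hGR₁ : (cmSplittingDatum (L : Type) (e₁) (frameD V) (frameD_real V) (frameD_ne V) (lineVec (L : Type) (dW S 1))
    (fun _ => dW_real S 1) (fun _ => dW_ne S 1)).CompatibleSplitting)
  (hGR₂ : (cmSplittingDatum (L : Type) (e₁) (frameD V) (frameD_real V) (frameD_ne V) (lineVec (L : Type) (dW' S 0))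
    (fun _ => dW'_real S 0) (fun _ => dW'_ne S 0)).CompatibleSplitting)
  (hGR₃ : (cmSplittingDatum (L : Type) (e₁) (frameD V) (frameD_real V) (frameD_ne V) (lineVec (L : Type) (dW' S 1))
    (fun _ => dW'_real S 1) (fun _ => dW'_ne S 1)).CompatibleSplitting)
  (η₀ η₁ η₂ η₃ : CMAdelic (L : Type) (frameD V) × CMAdelicOne (L : Type) →* ℂˣ)

/-- **(W-K∞′) `harm` of row 12 for line 0** — literally the `harm` hypothesis of
`archKTypeOf … (lineOmega_zero V S hGR hGR₀ hGR₁ η₀) … (blockFamilyOf (L:Type) e₁ (frameD V) … (lineVec (dW S 0)) … ι₁ (blockPosEquiv V)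
(blockNegEquiv V) Φ₁ Φ₂) …`, from (F) the frame matching on `Stab(x₀)`, (K) the pin's vacuum character `ev` at `v₁` for line 0,
(Φ) the `μ₀`-type of `Φ₁`, (χ) `c_0(u) · det A(u)^{e_P} · d(u)^{e_Q} = d̄(u)`. -/
theorem lineOmega_zero_harm
    (Φ₁ : Module.Dual ℂ (Fin 2 → ℂ) →ₗ[ℂ]
      SchwartzMap (DPIdx (Fin 2) Unit
        (PosIdx (cmXW (L : Type) (frameD V) (lineVec (L : Type) (dW S 0)) (fun _ => dW_real S 0) ι₁ (cmPlace (L : Type) ι₁)))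
        (NegIdx (cmXW (L : Type) (frameD V) (lineVec (L : Type) (dW S 0)) (fun _ => dW_real S 0) ι₁ (cmPlace (L : Type) ι₁))) → ℝ) ℂ)
    (Φ₂ : SchwartzMap ((Fin 3 × {v : {v : InfinitePlace ↥(maximalRealSubfield L) // v.IsReal} // v ≠ cmPlace (L : Type) ι₁}) → ℝ) ℂ)
    (hsec : ∀ u : stabilizer U21 x₀,
      cmBlockSection (L : Type) (frameD V) (frameD_real V) (frameD_ne V) (lineVec (L : Type) (dW S 0)) (fun _ => dW_real S 0)
          (fun _ => dW_ne S 0) ι₁ (blockPosEquiv V) (blockNegEquiv V) (u21FrameEquiv (u : U21), 1) = (archSectionFrameOf V u, 1))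
    {ev : VacExponents}
    (hK : ∀ (kk : DPK (Fin 2) Unit
        (PosIdx (cmXW (L : Type) (frameD V) (lineVec (L : Type) (dW S 0)) (fun _ => dW_real S 0) ι₁ (cmPlace (L : Type) ι₁)))
        (NegIdx (cmXW (L : Type) (frameD V) (lineVec (L : Type) (dW S 0)) (fun _ => dW_real S 0) ι₁ (cmPlace (L : Type) ι₁))))
      (Φ : SchwartzMap (DPIdx (Fin 2) Unit
        (PosIdx (cmXW (L : Type) (frameD V) (lineVec (L : Type) (dW S 0)) (fun _ => dW_real S 0) ι₁ (cmPlace (L : Type) ι₁)))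
        (NegIdx (cmXW (L : Type) (frameD V) (lineVec (L : Type) (dW S 0)) (fun _ => dW_real S 0) ι₁ (cmPlace (L : Type) ι₁))) → ℝ) ℂ),
      cmBlockRep (L : Type) e₁ (frameD V) (frameD_real V) (frameD_ne V) (lineVec (L : Type) (dW S 0)) (fun _ => dW_real S 0)
          (fun _ => dW_ne S 0) hGR₀ ι₁ (blockPosEquiv V) (blockNegEquiv V)
          (cmBlockSection (L : Type) (frameD V) (frameD_real V) (frameD_ne V) (lineVec (L : Type) (dW S 0)) (fun _ => dW_real S 0)
            (fun _ => dW_ne S 0) ι₁ (blockPosEquiv V) (blockNegEquiv V) (κ _ _ _ _ kk)) (tensorPi Φ Φ₂) =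
        tensorPi (κOp _ _ ev kk Φ) Φ₂)
    (hΦ₁ : ∀ (kV : Matrix.unitaryGroup (Fin 2) ℂ × Matrix.unitaryGroup Unit ℂ) (b : Fin 2 → ℂ),
      unitaryOpPi (dualPairι ((kV, 1) : DPK (Fin 2) Unit
          (PosIdx (cmXW (L : Type) (frameD V) (lineVec (L : Type) (dW S 0)) (fun _ => dW_real S 0) ι₁ (cmPlace (L : Type) ι₁)))
          (NegIdx (cmXW (L : Type) (frameD V) (lineVec (L : Type) (dW S 0)) (fun _ => dW_real S 0) ι₁ (cmPlace (L : Type) ι₁)))))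
          (Φ₁ (dotProductEquiv ℂ (Fin 2) b)) =
        Φ₁ (dotProductEquiv ℂ (Fin 2) ((kV.1 : Matrix (Fin 2) (Fin 2) ℂ) *ᵥ b)))
    (hχ : ∀ u : stabilizer U21 x₀,
      ((lineScalar_zero V S hGR hGR₀ hGR₁ η₀ (u : U21) : ℂˣ) : ℂ) *
          ((matA (stabilizerEquivK21.symm u)).det ^ ev.eP * sclD (stabilizerEquivK21.symm u) ^ ev.eQ) =
        star (sclD (stabilizerEquivK21.symm u)))
    (u : stabilizer U21 x₀) (ℓ : Module.Dual ℂ (Fin 2 → ℂ)) :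
    lineOmega_zero V S hGR hGR₀ hGR₁ η₀ (u : U21)
        (blockFamilyOf (L : Type) e₁ (frameD V) (frameD_real V) (frameD_ne V) (lineVec (L : Type) (dW S 0)) (fun _ => dW_real S 0)
          (fun _ => dW_ne S 0) ι₁ (blockPosEquiv V) (blockNegEquiv V) Φ₁ Φ₂ ℓ) =
      blockFamilyOf (L : Type) e₁ (frameD V) (frameD_real V) (frameD_ne V) (lineVec (L : Type) (dW S 0)) (fun _ => dW_real S 0)
          (fun _ => dW_ne S 0) ι₁ (blockPosEquiv V) (blockNegEquiv V) Φ₁ Φ₂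
        ((isPullbackCocycle_cotangentCocycle.weightOf x₀).dual u ℓ) :=
  smulPull_blockFamilyOf_harm V e₁ (lineVec (L : Type) (dW S 0)) (fun _ => dW_real S 0) (fun _ => dW_ne S 0) hGR₀
    (lineScalar_zero V S hGR hGR₀ hGR₁ η₀) Φ₁ Φ₂ hsec hK hΦ₁ hχ u ℓ

/-- **(W-K∞′) `harm` of row 12 for line 1** — literally the `harm` hypothesis of
`archKTypeOf … (lineOmega_one V S hGR hGR₀ hGR₁ η₁) … (blockFamilyOf (L:Type) e₁ (frameD V) … (lineVec (dW S 1)) … ι₁ (blockPosEquiv V)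
(blockNegEquiv V) Φ₁ Φ₂) …`, from (F) the frame matching on `Stab(x₀)`, (K) the pin's vacuum character `ev` at `v₁` for line 1,
(Φ) the `μ₀`-type of `Φ₁`, (χ) `c_1(u) · det A(u)^{e_P} · d(u)^{e_Q} = d̄(u)`. -/
theorem lineOmega_one_harm
    (Φ₁ : Module.Dual ℂ (Fin 2 → ℂ) →ₗ[ℂ]
      SchwartzMap (DPIdx (Fin 2) Unit
        (PosIdx (cmXW (L : Type) (frameD V) (lineVec (L : Type) (dW S 1)) (fun _ => dW_real S 1) ι₁ (cmPlace (L : Type) ι₁)))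
        (NegIdx (cmXW (L : Type) (frameD V) (lineVec (L : Type) (dW S 1)) (fun _ => dW_real S 1) ι₁ (cmPlace (L : Type) ι₁))) → ℝ) ℂ)
    (Φ₂ : SchwartzMap ((Fin 3 × {v : {v : InfinitePlace ↥(maximalRealSubfield L) // v.IsReal} // v ≠ cmPlace (L : Type) ι₁}) → ℝ) ℂ)
    (hsec : ∀ u : stabilizer U21 x₀,
      cmBlockSection (L : Type) (frameD V) (frameD_real V) (frameD_ne V) (lineVec (L : Type) (dW S 1)) (fun _ => dW_real S 1)
          (fun _ => dW_ne S 1) ι₁ (blockPosEquiv V) (blockNegEquiv V) (u21FrameEquiv (u : U21), 1) = (archSectionFrameOf V u, 1))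
    {ev : VacExponents}
    (hK : ∀ (kk : DPK (Fin 2) Unit
        (PosIdx (cmXW (L : Type) (frameD V) (lineVec (L : Type) (dW S 1)) (fun _ => dW_real S 1) ι₁ (cmPlace (L : Type) ι₁)))
        (NegIdx (cmXW (L : Type) (frameD V) (lineVec (L : Type) (dW S 1)) (fun _ => dW_real S 1) ι₁ (cmPlace (L : Type) ι₁))))
      (Φ : SchwartzMap (DPIdx (Fin 2) Unit
        (PosIdx (cmXW (L : Type) (frameD V) (lineVec (L : Type) (dW S 1)) (fun _ => dW_real S 1) ι₁ (cmPlace (L : Type) ι₁)))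
        (NegIdx (cmXW (L : Type) (frameD V) (lineVec (L : Type) (dW S 1)) (fun _ => dW_real S 1) ι₁ (cmPlace (L : Type) ι₁))) → ℝ) ℂ),
      cmBlockRep (L : Type) e₁ (frameD V) (frameD_real V) (frameD_ne V) (lineVec (L : Type) (dW S 1)) (fun _ => dW_real S 1)
          (fun _ => dW_ne S 1) hGR₁ ι₁ (blockPosEquiv V) (blockNegEquiv V)
          (cmBlockSection (L : Type) (frameD V) (frameD_real V) (frameD_ne V) (lineVec (L : Type) (dW S 1)) (fun _ => dW_real S 1)
            (fun _ => dW_ne S 1) ι₁ (blockPosEquiv V) (blockNegEquiv V) (κ _ _ _ _ kk)) (tensorPi Φ Φ₂) =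
        tensorPi (κOp _ _ ev kk Φ) Φ₂)
    (hΦ₁ : ∀ (kV : Matrix.unitaryGroup (Fin 2) ℂ × Matrix.unitaryGroup Unit ℂ) (b : Fin 2 → ℂ),
      unitaryOpPi (dualPairι ((kV, 1) : DPK (Fin 2) Unit
          (PosIdx (cmXW (L : Type) (frameD V) (lineVec (L : Type) (dW S 1)) (fun _ => dW_real S 1) ι₁ (cmPlace (L : Type) ι₁)))
          (NegIdx (cmXW (L : Type) (frameD V) (lineVec (L : Type) (dW S 1)) (fun _ => dW_real S 1) ι₁ (cmPlace (L : Type) ι₁)))))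
          (Φ₁ (dotProductEquiv ℂ (Fin 2) b)) =
        Φ₁ (dotProductEquiv ℂ (Fin 2) ((kV.1 : Matrix (Fin 2) (Fin 2) ℂ) *ᵥ b)))
    (hχ : ∀ u : stabilizer U21 x₀,
      ((lineScalar_one V S hGR hGR₀ hGR₁ η₁ (u : U21) : ℂˣ) : ℂ) *
          ((matA (stabilizerEquivK21.symm u)).det ^ ev.eP * sclD (stabilizerEquivK21.symm u) ^ ev.eQ) =
        star (sclD (stabilizerEquivK21.symm u)))
    (u : stabilizer U21 x₀) (ℓ : Module.Dual ℂ (Fin 2 → ℂ)) :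
    lineOmega_one V S hGR hGR₀ hGR₁ η₁ (u : U21)
        (blockFamilyOf (L : Type) e₁ (frameD V) (frameD_real V) (frameD_ne V) (lineVec (L : Type) (dW S 1)) (fun _ => dW_real S 1)
          (fun _ => dW_ne S 1) ι₁ (blockPosEquiv V) (blockNegEquiv V) Φ₁ Φ₂ ℓ) =
      blockFamilyOf (L : Type) e₁ (frameD V) (frameD_real V) (frameD_ne V) (lineVec (L : Type) (dW S 1)) (fun _ => dW_real S 1)
          (fun _ => dW_ne S 1) ι₁ (blockPosEquiv V) (blockNegEquiv V) Φ₁ Φ₂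
        ((isPullbackCocycle_cotangentCocycle.weightOf x₀).dual u ℓ) :=
  smulPull_blockFamilyOf_harm V e₁ (lineVec (L : Type) (dW S 1)) (fun _ => dW_real S 1) (fun _ => dW_ne S 1) hGR₁
    (lineScalar_one V S hGR hGR₀ hGR₁ η₁) Φ₁ Φ₂ hsec hK hΦ₁ hχ u ℓ


-- port_pkg: scope closed for this part
end ArchSideTerm
end HodgeCM.Model
end
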